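import Summits.QuantumFields.YangMills.Theorems.UnitScaleTiltProp7HermitianCoshBudgetCT
import HarnessLib

/-!
# Route `UnitScaleTilt`, crux K1 «MinimiserStabilityRegPr» (stmt-QuantumFields-19200), EX rows `h349` ∕ `hGF` (curved member) — **LOD LINE ENGINE (L0⁗) (★p1 g24): THE AGMON BOUND
# IN OPERATOR (ℓ²) FORM — conjugate-accretive ⟹ `‖e^{φ}·A⁻¹v‖₂ ≤ (1∕m′)·‖e^{φ}·v‖₂`, hence SET-TO-SET decay `‖𝟙_S A⁻¹ v‖₂ ≤ e^{−R}∕m′ · ‖v‖₂` for sources off which the weight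
# vanishes and targets where it is `≥ R`; Hermitian cosh-budget edition.**  WHY: the ENTRYWISE bounds of ✓p746925∕✓p747309 (`‖A⁻¹ i j‖ ≤ (4∕m)e^{−μd}`) turn into BLOCK-OPERATOR
# bounds only through Hilbert–Schmidt sums, which cost `η⁻³` at a member; the operator form below is K-UNIFORM as it stands — it is the currency the γ-row needs (CARD-19200-V3-g24 §5:
# block-L² decay of `G_a`, then of `M = Q″G_a²Q″†`, `P`, `DP`).

Cell `ym3-torus` (HUMAN RULING D-0037, YM ladder rung R3 — NOT d = 4, NOT a mass gap, NOT Clay).  Fleet lead seat `ym-ust-19200-p1` gen 24; ★★OWNER RULINGS №33∕№34.  THEOREMS ONLY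
(0 `def`, 0 `sorry`), Mathlib + this seat's engines; `--supports stmt-QuantumFields-19200 --as helper`, count-neutral.  HONEST LABEL (№33 (6)): curved γ-row supplier line (LOD
localisation); ENGINE lemma; nothing of (3.49), Thm 3.1∕3.3, `h349`, `hGF`, EX ∕ 19200 is proved.

WHAT IS PROVED (ns `Summit.QuantumFields.YangMills.Theorems.Prop7AccretiveConjOperatorBound`; `A : Matrix n n ℂ`; `‖v‖₂² := Σ_i ‖v i‖²` written as sums).
* §1 ★ `sum_normSq_inv_mulVec_le_of_accretive` — `m`-accretive `A` (`m > 0`): `Σ‖(A⁻¹v)_i‖² ≤ m⁻²·Σ‖v_i‖²` (Cauchy–Schwarz in `m‖w‖² ≤ Re⟨w, Aw⟩ = Re⟨w, v⟩`).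
* §2 ★★ `weighted_sum_normSq_inv_mulVec_le_of_conj_accretive` — `A` accretive, its `e^{φ}`-conjugate `m′`-accretive: `Σ e^{2φ_i}‖(A⁻¹v)_i‖² ≤ m′⁻²·Σ e^{2φ_i}‖v_i‖²` (the AGMON bound).
* §3 ★★★ `set_decay_of_conj_accretive` — if `φ_i = 0` wherever `v_i ≠ 0` and `R ≤ φ_i` on `S`: `Σ_{i∈S}‖(A⁻¹v)_i‖² ≤ e^{−2R}·m′⁻²·Σ‖v_i‖²`.
* §4 ★★★ `set_decay_of_hermitian_coshBudget` — Hermitian `m`-accretive `A`, pseudo-metric `d`, cosh-budget `Σ_l(cosh(μ d(i,l)) − 1)‖A i l‖ ≤ ϱ ≤ m∕2`, and any `d`-`μ`-Lipschitz weight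
  `φ ≥ 0` (`|φ_i − φ_l| ≤ μ d(i,l)`) vanishing on the source and `≥ R` on `S`: `Σ_{i∈S}‖(A⁻¹v)_i‖² ≤ e^{−2R}·(2∕m)²·Σ‖v_i‖²` — K-uniform block-to-block decay at a member.

References: S. Agmon, *Lectures on exponential decay* (1982) Ch. 1; T. Bałaban, CMP **99** (1985) 389–434 [Balaban1985BackgroundPropagators] (Thm 3.1 (3.46) p.398, (3.49) p.399).
-/

set_option autoImplicit false

noncomputable section

open scoped Matrix ComplexConjugate BigOperators
open Finset

namespace Summit.QuantumFields.YangMills.Theorems.Prop7AccretiveConjOperatorBound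

open Literature.MathematicalPhysics.QuantumFieldTheory.Balaban1983to89.B13Sqrt27Accretive (resolvent_bound_of_accretive)
open Summit.QuantumFields.YangMills.Theorems.Prop7AccretiveConjDecay (inv_apply_eq_conj_inv conj_accretive_of_formRelative)
open Summit.QuantumFields.YangMills.Theorems.Prop7HermitianCoshBudgetCT (re_form_conj_sub_ge_neg_budget)

variable {n : Type*} [Fintype n] [DecidableEq n]

/-! ## §1 Accretive ⟹ `ℓ²` bound of the inverse -/

omit [DecidableEq n] in
/-- Cauchy–Schwarz for the Hermitian pairing on `n → ℂ`: `|Re Σ w̄_i v_i| ≤ (Σ‖w_i‖²)^{1∕2}(Σ‖v_i‖²)^{1∕2}`. [cite: Balaban1985BackgroundPropagators, Thm 3.1 p.397] -/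
theorem re_sum_star_mul_le (w v : n → ℂ) :
    (∑ i, star (w i) * v i).re ≤ Real.sqrt (∑ i, ‖w i‖ ^ 2) * Real.sqrt (∑ i, ‖v i‖ ^ 2) := by
  calc (∑ i, star (w i) * v i).re ≤ ‖∑ i, star (w i) * v i‖ := Complex.re_le_norm _
    _ ≤ ∑ i, ‖star (w i) * v i‖ := norm_sum_le _ _
    _ = ∑ i, ‖w i‖ * ‖v i‖ := Finset.sum_congr rfl fun i _ => by rw [norm_mul, norm_star]
    _ ≤ Real.sqrt (∑ i, ‖w i‖ ^ 2) * Real.sqrt (∑ i, ‖v i‖ ^ 2) :=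
        Real.sum_mul_le_sqrt_mul_sqrt _ _ _

omit [DecidableEq n] in
/-- From `m·Σ‖w‖² ≤ Re Σ w̄ v` to `Σ‖w‖² ≤ m⁻² Σ‖v‖²`. [cite: Balaban1985BackgroundPropagators, Thm 3.1 p.397] -/
theorem sum_normSq_le_of_accretive_pairing {m : ℝ} (hm : 0 < m) (w v : n → ℂ)
    (h : m * ∑ i, ‖w i‖ ^ 2 ≤ (∑ i, star (w i) * v i).re) : ∑ i, ‖w i‖ ^ 2 ≤ m⁻¹ ^ 2 * ∑ i, ‖v i‖ ^ 2 := by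
  have hW : 0 ≤ ∑ i, ‖w i‖ ^ 2 := Finset.sum_nonneg fun i _ => by positivity
  have hV : 0 ≤ ∑ i, ‖v i‖ ^ 2 := Finset.sum_nonneg fun i _ => by positivity
  have hcs := h.trans (re_sum_star_mul_le w v)
  -- `m √W² ≤ √W √V` ⟹ `m √W ≤ √V` ⟹ `W ≤ V/m²`
  set W := ∑ i, ‖w i‖ ^ 2
  set V := ∑ i, ‖v i‖ ^ 2
  have hsqW : Real.sqrt W * Real.sqrt W = W := Real.mul_self_sqrt hW
  have h1 : m * Real.sqrt W ≤ Real.sqrt V := by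
    by_cases hW0 : Real.sqrt W = 0
    · rw [hW0, mul_zero]; exact Real.sqrt_nonneg _
    · have hpos : 0 < Real.sqrt W := lt_of_le_of_ne (Real.sqrt_nonneg _) (Ne.symm hW0)
      have : m * Real.sqrt W * Real.sqrt W ≤ Real.sqrt V * Real.sqrt W := by rw [mul_assoc, hsqW, mul_comm (Real.sqrt V)]; linarith
      exact le_of_mul_le_mul_right this hpos
  have h2 : (m * Real.sqrt W) ^ 2 ≤ (Real.sqrt V) ^ 2 := pow_le_pow_left₀ (by positivity) h1 2
  rw [mul_pow, Real.sq_sqrt hW, Real.sq_sqrt hV] at h2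
  have hm2 : 0 < m ^ 2 := by positivity
  calc W = m⁻¹ ^ 2 * (m ^ 2 * W) := by field_simp
    _ ≤ m⁻¹ ^ 2 * V := mul_le_mul_of_nonneg_left h2 (by positivity)

/-- ★ **ACCRETIVE ⟹ `ℓ²`-BOUNDED INVERSE**: `m`-accretive `A` (`m > 0`) is invertible and `Σ‖(A⁻¹v)_i‖² ≤ m⁻²·Σ‖v_i‖²`. [cite: Balaban1985BackgroundPropagators, Thm 3.1 p.397] -/
theorem sum_normSq_inv_mulVec_le_of_accretive (A : Matrix n n ℂ) {m : ℝ} (hm : 0 < m)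
    (hacc : ∀ v : n → ℂ, m * ∑ i, ‖v i‖ ^ 2 ≤ (∑ i, star (v i) * (A *ᵥ v) i).re) (v : n → ℂ) :
    IsUnit A.det ∧ ∑ i, ‖(A⁻¹ *ᵥ v) i‖ ^ 2 ≤ m⁻¹ ^ 2 * ∑ i, ‖v i‖ ^ 2 := by
  have hA : IsUnit A.det := by
    have h := (resolvent_bound_of_accretive A hm hacc le_rfl).1
    rwa [Complex.ofReal_zero, zero_smul, zero_add] at h
  refine ⟨hA, ?_⟩
  have hw := hacc (A⁻¹ *ᵥ v)
  rw [Matrix.mulVec_mulVec, Matrix.mul_nonsing_inv A hA, Matrix.one_mulVec] at hw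
  exact sum_normSq_le_of_accretive_pairing hm _ _ hw

/-! ## §2 The Agmon bound: conjugate-accretive ⟹ weighted `ℓ²` bound of the inverse -/

/-- The conjugated inverse acts on the weighted vector: `e^{φ_i}(A⁻¹v)_i = ((A_φ)⁻¹(e^{φ}v))_i`. [cite: Balaban1988RG2Cluster, (2.7) p.13] -/
theorem weight_inv_mulVec_eq (A : Matrix n n ℂ) (φ : n → ℝ) (hA : IsUnit A.det) (v : n → ℂ) (i : n) :
    (Real.exp (φ i) : ℂ) * (A⁻¹ *ᵥ v) i
      = ((Matrix.of fun a b => (Real.exp (φ a - φ b) : ℂ) * A a b)⁻¹ *ᵥ fun j => (Real.exp (φ j) : ℂ) * v j) i := by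
  rw [Matrix.mulVec, Matrix.mulVec, dotProduct, dotProduct, Finset.mul_sum]
  refine Finset.sum_congr rfl fun j _ => ?_
  rw [inv_apply_eq_conj_inv A φ hA i j]
  have h : (Real.exp (φ i) : ℂ) * (Real.exp (-(φ i - φ j)) : ℂ) = (Real.exp (φ j) : ℂ) := by
    rw [← Complex.ofReal_mul, ← Real.exp_add]; congr 1; ring_nf
  calc (Real.exp (φ i) : ℂ) * ((Real.exp (-(φ i - φ j)) : ℂ) * (Matrix.of fun a b => (Real.exp (φ a - φ b) : ℂ) * A a b)⁻¹ i j * v j)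
      = ((Real.exp (φ i) : ℂ) * (Real.exp (-(φ i - φ j)) : ℂ)) * (Matrix.of fun a b => (Real.exp (φ a - φ b) : ℂ) * A a b)⁻¹ i j * v j := by ring
    _ = (Matrix.of fun a b => (Real.exp (φ a - φ b) : ℂ) * A a b)⁻¹ i j * ((Real.exp (φ j) : ℂ) * v j) := by rw [h]; ring

/-- ★★ **THE AGMON BOUND**: `A` `m`-accretive (for invertibility) and its `e^{φ}`-conjugate `m′`-accretive ⟹ `Σ_i e^{2φ_i}‖(A⁻¹v)_i‖² ≤ m′⁻²·Σ_i e^{2φ_i}‖v_i‖²`.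
[cite: Balaban1985BackgroundPropagators, Thm 3.1 (3.46) p.398] -/
theorem weighted_sum_normSq_inv_mulVec_le_of_conj_accretive (A : Matrix n n ℂ) (φ : n → ℝ) {m m' : ℝ} (hm : 0 < m) (hm' : 0 < m')
    (hacc : ∀ v : n → ℂ, m * ∑ i, ‖v i‖ ^ 2 ≤ (∑ i, star (v i) * (A *ᵥ v) i).re)
    (hconj : ∀ v : n → ℂ, m' * ∑ i, ‖v i‖ ^ 2 ≤ (∑ i, star (v i) * ((Matrix.of fun a b => (Real.exp (φ a - φ b) : ℂ) * A a b) *ᵥ v) i).re)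
    (v : n → ℂ) :
    ∑ i, Real.exp (φ i) ^ 2 * ‖(A⁻¹ *ᵥ v) i‖ ^ 2 ≤ m'⁻¹ ^ 2 * ∑ i, Real.exp (φ i) ^ 2 * ‖v i‖ ^ 2 := by
  have hA : IsUnit A.det := by
    have h := (resolvent_bound_of_accretive A hm hacc le_rfl).1
    rwa [Complex.ofReal_zero, zero_smul, zero_add] at h
  have h := (sum_normSq_inv_mulVec_le_of_accretive _ hm' hconj (fun j => (Real.exp (φ j) : ℂ) * v j)).2
  have hl : ∀ i, Real.exp (φ i) ^ 2 * ‖(A⁻¹ *ᵥ v) i‖ ^ 2 = ‖((Matrix.of fun a b => (Real.exp (φ a - φ b) : ℂ) * A a b)⁻¹ *ᵥ fun j => (Real.exp (φ j) : ℂ) * v j) i‖ ^ 2 := by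
    intro i
    rw [← weight_inv_mulVec_eq A φ hA v i, norm_mul, Complex.norm_real, Real.norm_eq_abs, abs_of_pos (Real.exp_pos _), mul_pow]
  have hr : ∀ i, Real.exp (φ i) ^ 2 * ‖v i‖ ^ 2 = ‖(Real.exp (φ i) : ℂ) * v i‖ ^ 2 := by
    intro i
    rw [norm_mul, Complex.norm_real, Real.norm_eq_abs, abs_of_pos (Real.exp_pos _), mul_pow]
  simp_rw [hl, hr]
  exact h

/-! ## §3 Set-to-set decay -/

/-- ★★★ **SET-TO-SET DECAY FROM THE AGMON BOUND**: if the weight vanishes on the support of the source (`v_i ≠ 0 ⟹ φ_i = 0`) and is `≥ R` on the target set `S`, then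
`Σ_{i∈S}‖(A⁻¹v)_i‖² ≤ e^{−2R}·m′⁻²·Σ‖v_i‖²`. [cite: Balaban1985BackgroundPropagators, Thm 3.1 (3.46) p.398] -/
theorem set_decay_of_conj_accretive (A : Matrix n n ℂ) (φ : n → ℝ) {m m' R : ℝ} (hm : 0 < m) (hm' : 0 < m')
    (hacc : ∀ v : n → ℂ, m * ∑ i, ‖v i‖ ^ 2 ≤ (∑ i, star (v i) * (A *ᵥ v) i).re)
    (hconj : ∀ v : n → ℂ, m' * ∑ i, ‖v i‖ ^ 2 ≤ (∑ i, star (v i) * ((Matrix.of fun a b => (Real.exp (φ a - φ b) : ℂ) * A a b) *ᵥ v) i).re)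
    (v : n → ℂ) (hv : ∀ i, v i ≠ 0 → φ i = 0) (S : Finset n) (hS : ∀ i ∈ S, R ≤ φ i) :
    ∑ i ∈ S, ‖(A⁻¹ *ᵥ v) i‖ ^ 2 ≤ Real.exp (-R) ^ 2 * m'⁻¹ ^ 2 * ∑ i, ‖v i‖ ^ 2 := by
  have hag := weighted_sum_normSq_inv_mulVec_le_of_conj_accretive A φ hm hm' hacc hconj v
  -- right side: the weight is `1` on the support of `v`
  have hrhs : ∑ i, Real.exp (φ i) ^ 2 * ‖v i‖ ^ 2 = ∑ i, ‖v i‖ ^ 2 := by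
    refine Finset.sum_congr rfl fun i _ => ?_
    by_cases h0 : v i = 0
    · rw [h0, norm_zero]; ring
    · rw [hv i h0, Real.exp_zero]; ring
  rw [hrhs] at hag
  -- left side: on `S` the weight is `≥ e^{R}`
  have hS' : Real.exp R ^ 2 * ∑ i ∈ S, ‖(A⁻¹ *ᵥ v) i‖ ^ 2 ≤ ∑ i, Real.exp (φ i) ^ 2 * ‖(A⁻¹ *ᵥ v) i‖ ^ 2 := by
    rw [Finset.mul_sum]
    calc ∑ i ∈ S, Real.exp R ^ 2 * ‖(A⁻¹ *ᵥ v) i‖ ^ 2 ≤ ∑ i ∈ S, Real.exp (φ i) ^ 2 * ‖(A⁻¹ *ᵥ v) i‖ ^ 2 := by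
          refine Finset.sum_le_sum fun i hi => mul_le_mul_of_nonneg_right ?_ (by positivity)
          exact pow_le_pow_left₀ (Real.exp_pos _).le (Real.exp_le_exp.mpr (hS i hi)) 2
      _ ≤ ∑ i, Real.exp (φ i) ^ 2 * ‖(A⁻¹ *ᵥ v) i‖ ^ 2 :=
          Finset.sum_le_univ_sum_of_nonneg fun i => by positivity
  have hR : 0 < Real.exp R ^ 2 := by positivity
  have hmain : Real.exp R ^ 2 * ∑ i ∈ S, ‖(A⁻¹ *ᵥ v) i‖ ^ 2 ≤ m'⁻¹ ^ 2 * ∑ i, ‖v i‖ ^ 2 := hS'.trans hag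
  have hexp : Real.exp (-R) ^ 2 = (Real.exp R ^ 2)⁻¹ := by rw [Real.exp_neg, inv_pow]
  rw [hexp]
  calc ∑ i ∈ S, ‖(A⁻¹ *ᵥ v) i‖ ^ 2 = (Real.exp R ^ 2)⁻¹ * (Real.exp R ^ 2 * ∑ i ∈ S, ‖(A⁻¹ *ᵥ v) i‖ ^ 2) := by field_simp
    _ ≤ (Real.exp R ^ 2)⁻¹ * (m'⁻¹ ^ 2 * ∑ i, ‖v i‖ ^ 2) := mul_le_mul_of_nonneg_left hmain (by positivity)
    _ = (Real.exp R ^ 2)⁻¹ * m'⁻¹ ^ 2 * ∑ i, ‖v i‖ ^ 2 := by ring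

/-! ## §4 Hermitian cosh-budget edition -/

/-- ★★★ **SET-TO-SET DECAY UNDER THE COSH-BUDGET** (Hermitian `m`-accretive `A`, pseudo-metric `d`, `Σ_l (cosh(μ d(i,l)) − 1)‖A i l‖ ≤ ϱ ≤ m∕2`): for ANY weight `φ` that is
`μ·d`-Lipschitz (`|φ_i − φ_l| ≤ μ d(i,l)`), vanishes on the support of `v` and is `≥ R` on `S`: `Σ_{i∈S}‖(A⁻¹v)_i‖² ≤ e^{−2R}·(2∕m)²·Σ‖v_i‖²`.  (Member: `φ = μ·dist_d(·, supp v)`,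
K-uniform.) [cite: Balaban1985BackgroundPropagators, Thm 3.1 (3.46) p.398] -/
theorem set_decay_of_hermitian_coshBudget (d : n → n → ℝ) (A : Matrix n n ℂ) (hA : A.IsHermitian) {m μ ϱ R : ℝ} (hm : 0 < m) (hϱm : ϱ ≤ m / 2)
    (hacc : ∀ v : n → ℂ, m * ∑ i, ‖v i‖ ^ 2 ≤ (∑ i, star (v i) * (A *ᵥ v) i).re)
    (hrow : ∀ i, ∑ l, (Real.cosh (μ * d i l) - 1) * ‖A i l‖ ≤ ϱ)
    (φ : n → ℝ) (hlip : ∀ i l, |φ i - φ l| ≤ μ * d i l)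
    (v : n → ℂ) (hv : ∀ i, v i ≠ 0 → φ i = 0) (S : Finset n) (hS : ∀ i ∈ S, R ≤ φ i) :
    ∑ i ∈ S, ‖(A⁻¹ *ᵥ v) i‖ ^ 2 ≤ Real.exp (-R) ^ 2 * (m / 2)⁻¹ ^ 2 * ∑ i, ‖v i‖ ^ 2 := by
  -- the `φ`-conjugate is `(m − ϱ)`-accretive, hence `m/2`-accretive
  have hbudget : ∀ i, ∑ l, (Real.cosh (φ i - φ l) - 1) * ‖A i l‖ ≤ ϱ := by
    intro i
    refine le_trans (Finset.sum_le_sum fun l _ => ?_) (hrow i)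
    refine mul_le_mul_of_nonneg_right ?_ (norm_nonneg _)
    have h : Real.cosh (φ i - φ l) ≤ Real.cosh (μ * d i l) := Real.cosh_le_cosh.mpr ((hlip i l).trans (le_abs_self _))
    linarith
  have hconj : ∀ w : n → ℂ, m / 2 * ∑ i, ‖w i‖ ^ 2 ≤
      (∑ i, star (w i) * ((Matrix.of fun a b => (Real.exp (φ a - φ b) : ℂ) * A a b) *ᵥ w) i).re := by
    intro w
    have h := conj_accretive_of_formRelative A (Matrix.of fun a b => (Real.exp (φ a - φ b) : ℂ) * A a b)
      (θ := 0) (δ := ϱ) (m := m) zero_le_one hacc (fun u => by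
        have hb := re_form_conj_sub_ge_neg_budget A hA φ hbudget u
        simpa using hb) w
    have hW : 0 ≤ ∑ i, ‖w i‖ ^ 2 := Finset.sum_nonneg fun i _ => by positivity
    have : (1 - 0) * m - ϱ ≥ m / 2 := by linarith
    nlinarith
  exact set_decay_of_conj_accretive A φ hm (by linarith) hacc hconj v hv S hS

end Summit.QuantumFields.YangMills.Theorems.Prop7AccretiveConjOperatorBound

end
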